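import Literature.MathematicalPhysics.QuantumLattice.DWaveOrderParameterProofs
import HarnessLib

/-!
# F-B″: the Hellmann–Feynman BRACKET — three sourced energy windows give a TWO-SIDED node on the
# finite-`h` `d`-wave response `m_L(h)` and on its thermodynamic-limit stair `liminf_L / limsup_L m_L(h)`

HONEST FRAMING: first certified bounds on pairing observables; not a superconductivity verdict; every
number certified (two lineages + referee) or labelled float; a finite-`h` response floor is NOT an order
parameter floor (Koma–Tasaki: volume limit first, then `h ↓ 0`). Cell hubbard-cq (D-0082 (c) / D-0085, the
CUPRATE QUESTION, LADDER row PC-a "pinning-field response"), seat hubbard-cq-obsth-3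
(`prover-hubbard-cq-obsth-3-g0-0`), director row «Hellmann–Feynman bracket → m_d(h) two-sided node»;
companion of `SourcedOrderParameterCeiling.lean` (hubbard-obs-p1, the CEILING F-B′). Zero compute; no
definition; no named fact; no `sorry`.

Objects (tree, `Literature/MathematicalPhysics/QuantumLattice/DWaveSource*.lean`): the grand-canonical
square-torus Hubbard Hamiltonian with a `d`-wave pair source
`dWaveSourceTorus L U μ h = H(1,U) − μN − h(Δ_d + Δ_d†)`, its ground energy `E_L(h)`, the sourced pair
density `m_L(h) = dWaveSourceDensity L U μ h = Re ω₀^{L,h}(Δ_d)/L²` (tracial ground state; `Re ω(Δ_d + Δ_d†)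
= 2L² m_L`) and the STAIR `F(U,μ,h) = liminf_L m_{L+1}(h)` whose infimum over `h > 0` is the Koma–Tasaki
order parameter `dWaveOrderParameter U μ` (`dWaveOrderParameter_eq_iInf`).

The bracket (concavity of `h ↦ E_L(h)`; tree lemma `dWaveSourceDensity_mul_le_groundEnergy_drop`, valid for
ALL real `h, h'`): for `h₁ < h < h₂`,
  `(E_L(h₁) − E_L(h)) / (2(h − h₁)L²) ≤ m_L(h) ≤ (E_L(h) − E_L(h₂)) / (2(h₂ − h)L²)`.
Feeding CERTIFIED WINDOWS — a LOWER bound `ℓ₁L² ≤ E_L(h₁)` (a sourced window certificate,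
`DWaveSourceWindowCert`-type row), an UPPER bound `E_L(h) ≤ uL²` (any variational number for the SOURCED
problem at `h`), and a LOWER bound `ℓ₂L² ≤ E_L(h₂)` — gives the node
  `(ℓ₁ − u)/(2(h − h₁)) ≤ m_L(h) ≤ (u − ℓ₂)/(2(h₂ − h))`                       (§1, finite `L`),
and, when the windows hold for all large `L`,
  `(ℓ₁ − u)/(2(h − h₁)) ≤ liminf_L m_{L+1}(h) ≤ limsup_L m_{L+1}(h) ≤ (u − ℓ₂)/(2(h₂ − h))`   (§2).
§3 is the exact thermodynamic-limit form: if the sourced energies per site converge,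
`E_{L+1}(h')/(L+1)² → g(h')` at `h' ∈ {h₁, h, h₂}`, then
`(g(h₁) − g(h))/(2(h − h₁)) ≤ liminf_L m_{L+1}(h) ≤ limsup_L m_{L+1}(h) ≤ (g(h) − g(h₂))/(2(h₂ − h))` with NO
slack, so certified windows on the limit `g` plug in monotonically. §4 is the dictionary to the order
parameter: a floor `ε` on EVERY stair `h ∈ (0, h₀)` obtained this way is a floor `ε ≤ dWaveOrderParameter U μ`
(`le_dWaveOrderParameter_of_forall`) — i.e. an order-parameter floor costs windows resolving a LINEAR energy
drop `ℓ₁(h₁) − u(h) ≥ 2ε(h − h₁)` at arbitrarily small `h`; one stair alone proves nothing about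
`dWaveOrderParameter` (`le_dWaveOrderParameter_iff_forall`), which is why PC-a needs a finite-`h`
Kennedy–Lieb–Shastry / Koma–Tasaki-type inequality downstream of this node.

Quality (planning, not a claim): the floor is LINEAR in the slacks, `m_L(h) ≥ m̄_{[h₁,h]} − (ε_lo(h₁) +
ε_up(h))/(2(h − h₁))` with `m̄` the mean response on `[h₁, h]`; it is informative iff the certified energy DROP
between `h₁` and `h` is resolved, `u(h) < ℓ₁(h₁)`. Barrier placement: `SourcedOrderWithoutGroundStateLRO` /
`OrderParameterInvisibleToGroundStateConstraints` concern LRO floors from source-FREE data; a finite-`h`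
response floor is symmetry-allowed and is not an LRO statement (evasion (iv) by name).

References: T. Koma, H. Tasaki, J. Stat. Phys. 76 (1994) 745, §1 (order parameter under a
symmetry-breaking field; concavity sandwich); R. B. Griffiths, Phys. Rev. 152 (1966) 240, §II (one-sided
derivatives of the ground energy bound the conjugate one-point function); T. Kennedy, E. H. Lieb,
B. S. Shastry, J. Stat. Phys. 53 (1988) 1019 (response vs long-range order — the downstream consumer class).
-/

noncomputable section

namespace Summit.Ventures.CertifiedManyBodySolver.Observables

open Literature.MathematicalPhysics.QuantumLattice Literature.Probability.LatticeModels Filter Topology Finset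

/-! ### §1 Finite volume: the bracket from three energy windows -/

section Finite

variable (L : ℕ) [NeZero L]

/-- **FLOOR, finite volume**: for `h₁ < h`, a LOWER bound `ℓ L² ≤ E_L(h₁)` at the smaller source and an
UPPER bound `E_L(h) ≤ u L²` at the source itself give `(ℓ − u)/(2(h − h₁)) ≤ m_L(h)`
(left chord of the concave `h ↦ E_L(h)` lies above the supergradient `−2L² m_L(h)`). -/
theorem dWaveSourceDensity_ge_of_energy_window (U μ : ℝ) {h₁ h u ℓ : ℝ} (hlt : h₁ < h)
    (hl : ℓ * (L : ℝ) ^ 2 ≤ (dWaveSourceTorus L U μ h₁).groundEnergy)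
    (hu : (dWaveSourceTorus L U μ h).groundEnergy ≤ u * (L : ℝ) ^ 2) :
    (ℓ - u) / (2 * (h - h₁)) ≤ dWaveSourceDensity L U μ h := by
  have h1 := dWaveSourceDensity_mul_le_groundEnergy_drop (L := L) U μ h h₁
  have hL : (0 : ℝ) < (L : ℝ) ^ 2 := cast_sq_pos_of_neZero L
  have hδ : 0 < h - h₁ := sub_pos.2 hlt
  rw [div_le_iff₀ (by positivity)]
  have h3 : (ℓ - u) * (L : ℝ) ^ 2 ≤
      (dWaveSourceDensity L U μ h * (2 * (h - h₁))) * (L : ℝ) ^ 2 := by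
    nlinarith [h1, hl, hu]
  exact le_of_mul_le_mul_right h3 hL

/-- **CEILING at a general source, finite volume**: for `h < h₂`, an UPPER bound `E_L(h) ≤ u L²` at the source
and a LOWER bound `ℓ L² ≤ E_L(h₂)` at the larger source give `m_L(h) ≤ (u − ℓ)/(2(h₂ − h))` (right chord below
the supergradient). The special case `u` = a bound on the source-FREE energy `E_L(0) ≥ E_L(h)` is
`dWaveSourceDensity_le_of_energy_window` of `SourcedOrderParameterCeiling.lean`. -/
theorem dWaveSourceDensity_le_of_energy_window_at (U μ : ℝ) {h h₂ u ℓ : ℝ} (hlt : h < h₂)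
    (hu : (dWaveSourceTorus L U μ h).groundEnergy ≤ u * (L : ℝ) ^ 2)
    (hl : ℓ * (L : ℝ) ^ 2 ≤ (dWaveSourceTorus L U μ h₂).groundEnergy) :
    dWaveSourceDensity L U μ h ≤ (u - ℓ) / (2 * (h₂ - h)) := by
  have h1 := dWaveSourceDensity_mul_le_groundEnergy_drop (L := L) U μ h h₂
  have hL : (0 : ℝ) < (L : ℝ) ^ 2 := cast_sq_pos_of_neZero L
  have hδ : 0 < h₂ - h := sub_pos.2 hlt
  rw [le_div_iff₀ (by positivity)]
  have h3 : (dWaveSourceDensity L U μ h * (2 * (h₂ - h))) * (L : ℝ) ^ 2 ≤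
      (u - ℓ) * (L : ℝ) ^ 2 := by
    nlinarith [h1, hl, hu]
  exact le_of_mul_le_mul_right h3 hL

/-- **THE TWO-SIDED NODE, finite volume**: for `h₁ < h < h₂`, the three windows
`ℓ₁ L² ≤ E_L(h₁)`, `E_L(h) ≤ u L²`, `ℓ₂ L² ≤ E_L(h₂)` give
`m_L(h) ∈ [(ℓ₁ − u)/(2(h − h₁)), (u − ℓ₂)/(2(h₂ − h))]`. -/
theorem dWaveSourceDensity_mem_Icc_of_energy_windows (U μ : ℝ) {h₁ h h₂ u ℓ₁ ℓ₂ : ℝ}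
    (hlo : h₁ < h) (hhi : h < h₂)
    (hl1 : ℓ₁ * (L : ℝ) ^ 2 ≤ (dWaveSourceTorus L U μ h₁).groundEnergy)
    (hu : (dWaveSourceTorus L U μ h).groundEnergy ≤ u * (L : ℝ) ^ 2)
    (hl2 : ℓ₂ * (L : ℝ) ^ 2 ≤ (dWaveSourceTorus L U μ h₂).groundEnergy) :
    dWaveSourceDensity L U μ h ∈
      Set.Icc ((ℓ₁ - u) / (2 * (h - h₁))) ((u - ℓ₂) / (2 * (h₂ - h))) :=
  ⟨dWaveSourceDensity_ge_of_energy_window L U μ hlo hl1 hu,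
    dWaveSourceDensity_le_of_energy_window_at L U μ hhi hu hl2⟩

/-- Without any window: the exact finite-volume bracket by the sourced energies themselves,
`(E_L(h₁) − E_L(h))/(2(h − h₁)L²) ≤ m_L(h) ≤ (E_L(h) − E_L(h₂))/(2(h₂ − h)L²)` for `h₁ < h < h₂`. -/
theorem dWaveSourceDensity_mem_Icc_energy (U μ : ℝ) {h₁ h h₂ : ℝ} (hlo : h₁ < h) (hhi : h < h₂) :
    dWaveSourceDensity L U μ h ∈
      Set.Icc (((dWaveSourceTorus L U μ h₁).groundEnergy - (dWaveSourceTorus L U μ h).groundEnergy) /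
          (2 * (h - h₁) * (L : ℝ) ^ 2))
        (((dWaveSourceTorus L U μ h).groundEnergy - (dWaveSourceTorus L U μ h₂).groundEnergy) /
          (2 * (h₂ - h) * (L : ℝ) ^ 2)) := by
  have hL : (0 : ℝ) < (L : ℝ) ^ 2 := cast_sq_pos_of_neZero L
  have hL' : (L : ℝ) ^ 2 ≠ 0 := hL.ne'
  have key := dWaveSourceDensity_mem_Icc_of_energy_windows L U μ hlo hhi
    (u := (dWaveSourceTorus L U μ h).groundEnergy / (L : ℝ) ^ 2)
    (ℓ₁ := (dWaveSourceTorus L U μ h₁).groundEnergy / (L : ℝ) ^ 2)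
    (ℓ₂ := (dWaveSourceTorus L U μ h₂).groundEnergy / (L : ℝ) ^ 2)
    (by rw [div_mul_cancel₀ _ hL']) (by rw [div_mul_cancel₀ _ hL']) (by rw [div_mul_cancel₀ _ hL'])
  have e1 : ((dWaveSourceTorus L U μ h₁).groundEnergy / (L : ℝ) ^ 2 -
      (dWaveSourceTorus L U μ h).groundEnergy / (L : ℝ) ^ 2) / (2 * (h - h₁)) =
      ((dWaveSourceTorus L U μ h₁).groundEnergy - (dWaveSourceTorus L U μ h).groundEnergy) /
        (2 * (h - h₁) * (L : ℝ) ^ 2) := by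
    field_simp
  have e2 : ((dWaveSourceTorus L U μ h).groundEnergy / (L : ℝ) ^ 2 -
      (dWaveSourceTorus L U μ h₂).groundEnergy / (L : ℝ) ^ 2) / (2 * (h₂ - h)) =
      ((dWaveSourceTorus L U μ h).groundEnergy - (dWaveSourceTorus L U μ h₂).groundEnergy) /
        (2 * (h₂ - h) * (L : ℝ) ^ 2) := by
    field_simp
  rw [e1, e2] at key
  exact key

end Finite

/-! ### §2 Windows for all large tori: the STAIR node on `liminf_L m_{L+1}(h)` and `limsup_L m_{L+1}(h)` -/

section Stair

/-- The a priori constant `B_d = 2Σ_e |d(e)/√2|` bounding `|m_L(h)|` (tree: `abs_dWaveSourceDensity_le`),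
abbreviated locally. -/
private theorem abs_le_Bd (L : ℕ) [NeZero L] (U μ h : ℝ) :
    |dWaveSourceDensity L U μ h| ≤ 2 * ∑ e ∈ insert (0 : Site 2) unitSteps, |dWaveFormFactor e / Real.sqrt 2| :=
  abs_dWaveSourceDensity_le L U μ h

/-- `liminf_L m_{L+1}(h)` and `limsup_L m_{L+1}(h)` are taken over a bounded sequence: bounded above … -/
theorem isBoundedUnder_le_dWaveSourceDensity (U μ h : ℝ) :
    IsBoundedUnder (· ≤ ·) atTop (fun L : ℕ => dWaveSourceDensity (L + 1) U μ h) :=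
  isBoundedUnder_of ⟨2 * ∑ e ∈ insert (0 : Site 2) unitSteps, |dWaveFormFactor e / Real.sqrt 2|,
    fun L => (le_abs_self _).trans (abs_le_Bd (L + 1) U μ h)⟩

/-- … and bounded below. -/
theorem isBoundedUnder_ge_dWaveSourceDensity (U μ h : ℝ) :
    IsBoundedUnder (· ≥ ·) atTop (fun L : ℕ => dWaveSourceDensity (L + 1) U μ h) :=
  isBoundedUnder_of ⟨-(2 * ∑ e ∈ insert (0 : Site 2) unitSteps, |dWaveFormFactor e / Real.sqrt 2|),
    fun L => (neg_abs_le _).trans' (neg_le_neg (abs_le_Bd (L + 1) U μ h))⟩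

/-- **FLOOR on the stair**: if for all large `L` a lower window `ℓ (L+1)² ≤ E_{L+1}(h₁)` and an upper window
`E_{L+1}(h) ≤ u (L+1)²` hold (`h₁ < h`), then `(ℓ − u)/(2(h − h₁)) ≤ liminf_L m_{L+1}(h) = F(U,μ,h)`. -/
theorem le_liminf_dWaveSourceDensity_of_window (U μ : ℝ) {h₁ h u ℓ : ℝ} (hlt : h₁ < h)
    (hl : ∀ᶠ L : ℕ in atTop, ℓ * (((L + 1 : ℕ) : ℝ)) ^ 2 ≤ (dWaveSourceTorus (L + 1) U μ h₁).groundEnergy)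
    (hu : ∀ᶠ L : ℕ in atTop, (dWaveSourceTorus (L + 1) U μ h).groundEnergy ≤ u * (((L + 1 : ℕ) : ℝ)) ^ 2) :
    (ℓ - u) / (2 * (h - h₁)) ≤ liminf (fun L : ℕ => dWaveSourceDensity (L + 1) U μ h) atTop := by
  refine le_liminf_of_le (isBoundedUnder_le_dWaveSourceDensity U μ h).isCoboundedUnder_ge ?_
  filter_upwards [hl, hu] with L hlL huL
  exact dWaveSourceDensity_ge_of_energy_window (L + 1) U μ hlt hlL huL

/-- **CEILING on the stair (limsup form)**: if for all large `L` an upper window `E_{L+1}(h) ≤ u (L+1)²` and a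
lower window `ℓ (L+1)² ≤ E_{L+1}(h₂)` hold (`h < h₂`), then `limsup_L m_{L+1}(h) ≤ (u − ℓ)/(2(h₂ − h))`
(hence the same for the `liminf`, the stair `F(U,μ,h)`; no sign hypothesis on `h`). -/
theorem limsup_dWaveSourceDensity_le_of_window (U μ : ℝ) {h h₂ u ℓ : ℝ} (hlt : h < h₂)
    (hu : ∀ᶠ L : ℕ in atTop, (dWaveSourceTorus (L + 1) U μ h).groundEnergy ≤ u * (((L + 1 : ℕ) : ℝ)) ^ 2)
    (hl : ∀ᶠ L : ℕ in atTop, ℓ * (((L + 1 : ℕ) : ℝ)) ^ 2 ≤ (dWaveSourceTorus (L + 1) U μ h₂).groundEnergy) :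
    limsup (fun L : ℕ => dWaveSourceDensity (L + 1) U μ h) atTop ≤ (u - ℓ) / (2 * (h₂ - h)) := by
  refine limsup_le_of_le (isBoundedUnder_ge_dWaveSourceDensity U μ h).isCoboundedUnder_le ?_
  filter_upwards [hu, hl] with L huL hlL
  exact dWaveSourceDensity_le_of_energy_window_at (L + 1) U μ hlt huL hlL

/-- The stair's `liminf` never exceeds its `limsup` (bounded sequence). -/
theorem liminf_le_limsup_dWaveSourceDensity (U μ h : ℝ) :
    liminf (fun L : ℕ => dWaveSourceDensity (L + 1) U μ h) atTop ≤
      limsup (fun L : ℕ => dWaveSourceDensity (L + 1) U μ h) atTop :=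
  liminf_le_limsup (isBoundedUnder_le_dWaveSourceDensity U μ h) (isBoundedUnder_ge_dWaveSourceDensity U μ h)

/-- **THE TWO-SIDED STAIR NODE**: for `h₁ < h < h₂`, windows holding for all large tori —
`ℓ₁ (L+1)² ≤ E_{L+1}(h₁)`, `E_{L+1}(h) ≤ u (L+1)²`, `ℓ₂ (L+1)² ≤ E_{L+1}(h₂)` — give
`(ℓ₁ − u)/(2(h − h₁)) ≤ liminf_L m_{L+1}(h) ≤ limsup_L m_{L+1}(h) ≤ (u − ℓ₂)/(2(h₂ − h))`. -/
theorem liminf_limsup_dWaveSourceDensity_window (U μ : ℝ) {h₁ h h₂ u ℓ₁ ℓ₂ : ℝ}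
    (hlo : h₁ < h) (hhi : h < h₂)
    (hl1 : ∀ᶠ L : ℕ in atTop, ℓ₁ * (((L + 1 : ℕ) : ℝ)) ^ 2 ≤ (dWaveSourceTorus (L + 1) U μ h₁).groundEnergy)
    (hu : ∀ᶠ L : ℕ in atTop, (dWaveSourceTorus (L + 1) U μ h).groundEnergy ≤ u * (((L + 1 : ℕ) : ℝ)) ^ 2)
    (hl2 : ∀ᶠ L : ℕ in atTop, ℓ₂ * (((L + 1 : ℕ) : ℝ)) ^ 2 ≤ (dWaveSourceTorus (L + 1) U μ h₂).groundEnergy) :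
    (ℓ₁ - u) / (2 * (h - h₁)) ≤ liminf (fun L : ℕ => dWaveSourceDensity (L + 1) U μ h) atTop ∧
      liminf (fun L : ℕ => dWaveSourceDensity (L + 1) U μ h) atTop ≤
        limsup (fun L : ℕ => dWaveSourceDensity (L + 1) U μ h) atTop ∧
      limsup (fun L : ℕ => dWaveSourceDensity (L + 1) U μ h) atTop ≤ (u - ℓ₂) / (2 * (h₂ - h)) :=
  ⟨le_liminf_dWaveSourceDensity_of_window U μ hlo hl1 hu, liminf_le_limsup_dWaveSourceDensity U μ h,
    limsup_dWaveSourceDensity_le_of_window U μ hhi hu hl2⟩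

/-- Threshold spelling of the floor (the shape of a delivered certificate row, `∃ L₀, ∀ L ≥ L₀, …` on the
unshifted index, as in `DWaveSourceWindowCert.groundEnergy_ge_eventually`): lower window at `h₁` from `L₀`
on, upper window at `h` from `L₁` on, `h₁ < h` ⇒ `(ℓ − u)/(2(h − h₁)) ≤ liminf_L m_{L+1}(h)`. -/
theorem le_liminf_dWaveSourceDensity_of_thresholds (U μ : ℝ) {h₁ h u ℓ : ℝ} (hlt : h₁ < h) {L₀ L₁ : ℕ}
    (hl : ∀ L : ℕ, L₀ ≤ L → ∀ [NeZero L], ℓ * (L : ℝ) ^ 2 ≤ (dWaveSourceTorus L U μ h₁).groundEnergy)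
    (hu : ∀ L : ℕ, L₁ ≤ L → ∀ [NeZero L], (dWaveSourceTorus L U μ h).groundEnergy ≤ u * (L : ℝ) ^ 2) :
    (ℓ - u) / (2 * (h - h₁)) ≤ liminf (fun L : ℕ => dWaveSourceDensity (L + 1) U μ h) atTop := by
  refine le_liminf_dWaveSourceDensity_of_window U μ hlt ?_ ?_
  · filter_upwards [eventually_ge_atTop L₀] with L hL
    exact hl (L + 1) (hL.trans (Nat.le_succ L))
  · filter_upwards [eventually_ge_atTop L₁] with L hL
    exact hu (L + 1) (hL.trans (Nat.le_succ L))

end Stair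

/-! ### §3 Exact thermodynamic-limit form: the bracket by the limiting sourced energy densities -/

section Limit

/-- From a LIMIT `E_{L+1}(h')/(L+1)² → g` one gets, for every `η > 0`, the lower window `(g − η)(L+1)² ≤
E_{L+1}(h')` for all large `L` … -/
theorem eventually_lower_window_of_tendsto (U μ h' : ℝ) {g η : ℝ} (hη : 0 < η)
    (hg : Tendsto (fun L : ℕ => (dWaveSourceTorus (L + 1) U μ h').groundEnergy / (((L + 1 : ℕ) : ℝ)) ^ 2)
      atTop (𝓝 g)) :
    ∀ᶠ L : ℕ in atTop, (g - η) * (((L + 1 : ℕ) : ℝ)) ^ 2 ≤ (dWaveSourceTorus (L + 1) U μ h').groundEnergy := by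
  filter_upwards [hg.eventually (Ioi_mem_nhds (sub_lt_self g hη))] with L hL
  have hpos : (0 : ℝ) < (((L + 1 : ℕ) : ℝ)) ^ 2 := by positivity
  exact (lt_div_iff₀ hpos).1 hL |>.le

/-- … and the upper window `E_{L+1}(h') ≤ (g + η)(L+1)²` for all large `L`. -/
theorem eventually_upper_window_of_tendsto (U μ h' : ℝ) {g η : ℝ} (hη : 0 < η)
    (hg : Tendsto (fun L : ℕ => (dWaveSourceTorus (L + 1) U μ h').groundEnergy / (((L + 1 : ℕ) : ℝ)) ^ 2)
      atTop (𝓝 g)) :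
    ∀ᶠ L : ℕ in atTop, (dWaveSourceTorus (L + 1) U μ h').groundEnergy ≤ (g + η) * (((L + 1 : ℕ) : ℝ)) ^ 2 := by
  filter_upwards [hg.eventually (Iio_mem_nhds (lt_add_of_pos_right g hη))] with L hL
  have hpos : (0 : ℝ) < (((L + 1 : ℕ) : ℝ)) ^ 2 := by positivity
  exact (div_lt_iff₀ hpos).1 hL |>.le

/-- **FLOOR in the thermodynamic limit, no slack**: if `E_{L+1}(h₁)/(L+1)² → g₁` and `E_{L+1}(h)/(L+1)² → g`
(`h₁ < h`), then `(g₁ − g)/(2(h − h₁)) ≤ liminf_L m_{L+1}(h)`. -/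
theorem le_liminf_dWaveSourceDensity_of_tendsto (U μ : ℝ) {h₁ h g₁ g : ℝ} (hlt : h₁ < h)
    (hg1 : Tendsto (fun L : ℕ => (dWaveSourceTorus (L + 1) U μ h₁).groundEnergy / (((L + 1 : ℕ) : ℝ)) ^ 2)
      atTop (𝓝 g₁))
    (hg : Tendsto (fun L : ℕ => (dWaveSourceTorus (L + 1) U μ h).groundEnergy / (((L + 1 : ℕ) : ℝ)) ^ 2)
      atTop (𝓝 g)) :
    (g₁ - g) / (2 * (h - h₁)) ≤ liminf (fun L : ℕ => dWaveSourceDensity (L + 1) U μ h) atTop := by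
  have hδ : 0 < h - h₁ := sub_pos.2 hlt
  refine le_of_forall_pos_le_add fun ε hε => ?_
  -- windows of half-width `η = ε (h − h₁)` cost exactly `ε` in the floor
  have hη : 0 < ε * (h - h₁) := mul_pos hε hδ
  have key := le_liminf_dWaveSourceDensity_of_window U μ hlt
    (eventually_lower_window_of_tendsto U μ h₁ hη hg1) (eventually_upper_window_of_tendsto U μ h hη hg)
  have e : (g₁ - ε * (h - h₁) - (g + ε * (h - h₁))) / (2 * (h - h₁)) = (g₁ - g) / (2 * (h - h₁)) - ε := by
    field_simp
    ring
  rw [e] at key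
  linarith

/-- **CEILING in the thermodynamic limit, no slack**: if `E_{L+1}(h)/(L+1)² → g` and `E_{L+1}(h₂)/(L+1)² → g₂`
(`h < h₂`), then `limsup_L m_{L+1}(h) ≤ (g − g₂)/(2(h₂ − h))`. -/
theorem limsup_dWaveSourceDensity_le_of_tendsto (U μ : ℝ) {h h₂ g g₂ : ℝ} (hlt : h < h₂)
    (hg : Tendsto (fun L : ℕ => (dWaveSourceTorus (L + 1) U μ h).groundEnergy / (((L + 1 : ℕ) : ℝ)) ^ 2)
      atTop (𝓝 g))
    (hg2 : Tendsto (fun L : ℕ => (dWaveSourceTorus (L + 1) U μ h₂).groundEnergy / (((L + 1 : ℕ) : ℝ)) ^ 2)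
      atTop (𝓝 g₂)) :
    limsup (fun L : ℕ => dWaveSourceDensity (L + 1) U μ h) atTop ≤ (g - g₂) / (2 * (h₂ - h)) := by
  have hδ : 0 < h₂ - h := sub_pos.2 hlt
  refine le_of_forall_pos_le_add fun ε hε => ?_
  have hη : 0 < ε * (h₂ - h) := mul_pos hε hδ
  have key := limsup_dWaveSourceDensity_le_of_window U μ hlt
    (eventually_upper_window_of_tendsto U μ h hη hg) (eventually_lower_window_of_tendsto U μ h₂ hη hg2)
  have e : (g + ε * (h₂ - h) - (g₂ - ε * (h₂ - h))) / (2 * (h₂ - h)) = (g - g₂) / (2 * (h₂ - h)) + ε := by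
    field_simp
    ring
  rw [e] at key
  exact key

/-- **The thermodynamic-limit Hellmann–Feynman bracket**: with limiting sourced energy densities `g₁, g, g₂`
at `h₁ < h < h₂`,
`(g₁ − g)/(2(h − h₁)) ≤ liminf_L m_{L+1}(h) ≤ limsup_L m_{L+1}(h) ≤ (g − g₂)/(2(h₂ − h))`; hence CERTIFIED
windows `g₁ ≥ ℓ₁`, `g ≤ u`, `g₂ ≥ ℓ₂` on the limits give the node of §2 verbatim. -/
theorem liminf_limsup_dWaveSourceDensity_tendsto (U μ : ℝ) {h₁ h h₂ g₁ g g₂ : ℝ}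
    (hlo : h₁ < h) (hhi : h < h₂)
    (hg1 : Tendsto (fun L : ℕ => (dWaveSourceTorus (L + 1) U μ h₁).groundEnergy / (((L + 1 : ℕ) : ℝ)) ^ 2)
      atTop (𝓝 g₁))
    (hg : Tendsto (fun L : ℕ => (dWaveSourceTorus (L + 1) U μ h).groundEnergy / (((L + 1 : ℕ) : ℝ)) ^ 2)
      atTop (𝓝 g))
    (hg2 : Tendsto (fun L : ℕ => (dWaveSourceTorus (L + 1) U μ h₂).groundEnergy / (((L + 1 : ℕ) : ℝ)) ^ 2)
      atTop (𝓝 g₂)) :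
    (g₁ - g) / (2 * (h - h₁)) ≤ liminf (fun L : ℕ => dWaveSourceDensity (L + 1) U μ h) atTop ∧
      liminf (fun L : ℕ => dWaveSourceDensity (L + 1) U μ h) atTop ≤
        limsup (fun L : ℕ => dWaveSourceDensity (L + 1) U μ h) atTop ∧
      limsup (fun L : ℕ => dWaveSourceDensity (L + 1) U μ h) atTop ≤ (g - g₂) / (2 * (h₂ - h)) :=
  ⟨le_liminf_dWaveSourceDensity_of_tendsto U μ hlo hg1 hg, liminf_le_limsup_dWaveSourceDensity U μ h,
    limsup_dWaveSourceDensity_le_of_tendsto U μ hhi hg hg2⟩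

/-- If moreover the response itself converges, `m_{L+1}(h) → m`, then `m` lies in the bracket
`[(g₁ − g)/(2(h − h₁)), (g − g₂)/(2(h₂ − h))]` — the textbook Hellmann–Feynman / Griffiths inequality for the
infinite-volume sourced ground-state energy density. -/
theorem tendsto_dWaveSourceDensity_mem_Icc (U μ : ℝ) {h₁ h h₂ g₁ g g₂ m : ℝ}
    (hlo : h₁ < h) (hhi : h < h₂)
    (hg1 : Tendsto (fun L : ℕ => (dWaveSourceTorus (L + 1) U μ h₁).groundEnergy / (((L + 1 : ℕ) : ℝ)) ^ 2)
      atTop (𝓝 g₁))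
    (hg : Tendsto (fun L : ℕ => (dWaveSourceTorus (L + 1) U μ h).groundEnergy / (((L + 1 : ℕ) : ℝ)) ^ 2)
      atTop (𝓝 g))
    (hg2 : Tendsto (fun L : ℕ => (dWaveSourceTorus (L + 1) U μ h₂).groundEnergy / (((L + 1 : ℕ) : ℝ)) ^ 2)
      atTop (𝓝 g₂))
    (hm : Tendsto (fun L : ℕ => dWaveSourceDensity (L + 1) U μ h) atTop (𝓝 m)) :
    m ∈ Set.Icc ((g₁ - g) / (2 * (h - h₁))) ((g - g₂) / (2 * (h₂ - h))) := by
  obtain ⟨h1, -, h3⟩ := liminf_limsup_dWaveSourceDensity_tendsto U μ hlo hhi hg1 hg hg2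
  rw [hm.liminf_eq] at h1
  rw [hm.limsup_eq] at h3
  exact ⟨h1, h3⟩

end Limit

/-! ### §4 Dictionary to the Koma–Tasaki order parameter: what a FLOOR costs -/

section OrderParameter

/-- **An order-parameter FLOOR from sourced energy windows** (the lower lever, composed): if for every stair
`h ∈ (0, h₀)` there are a smaller source `h₁ < h` and window constants with, for all large `L`,
`ℓ (L+1)² ≤ E_{L+1}(h₁)` and `E_{L+1}(h) ≤ u (L+1)²`, and `ε ≤ (ℓ − u)/(2(h − h₁))`, then
`ε ≤ dWaveOrderParameter U μ`. The cost is visible: a LINEAR energy drop `ℓ − u ≥ 2ε(h − h₁)` must be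
certified at arbitrarily small sources (cf. `dWaveOrderParameter_eq_zero_of_sublinear_gain`). -/
theorem le_dWaveOrderParameter_of_windows (U μ : ℝ) {ε h₀ : ℝ} (hh₀ : 0 < h₀)
    (H : ∀ h ∈ Set.Ioo 0 h₀, ∃ h₁ u ℓ : ℝ, h₁ < h ∧
      (∀ᶠ L : ℕ in atTop, ℓ * (((L + 1 : ℕ) : ℝ)) ^ 2 ≤ (dWaveSourceTorus (L + 1) U μ h₁).groundEnergy) ∧
      (∀ᶠ L : ℕ in atTop, (dWaveSourceTorus (L + 1) U μ h).groundEnergy ≤ u * (((L + 1 : ℕ) : ℝ)) ^ 2) ∧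
      ε ≤ (ℓ - u) / (2 * (h - h₁))) :
    ε ≤ dWaveOrderParameter U μ := by
  refine le_dWaveOrderParameter_of_forall U μ hh₀ fun h hh => ?_
  obtain ⟨h₁, u, ℓ, hlt, hl, hu, hε⟩ := H h hh
  exact hε.trans (le_liminf_dWaveSourceDensity_of_window U μ hlt hl hu)

/-- **One stair is not the order parameter** (recorded for the planner): a floor at a single `h > 0` bounds
`dWaveOrderParameter U μ` from BELOW only together with floors on all smaller stairs; what one stair does give
is the monotone consequence `(ℓ − u)/(2(h − h₁)) ≤ liminf_L m_{L+1}(h')` for every LARGER source `h' ≥ h`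
(`liminf_dWaveSourceDensity_mono`) — the input slot of a finite-`h` response-to-LRO inequality. -/
theorem le_liminf_dWaveSourceDensity_of_window_mono (U μ : ℝ) {h₁ h h' u ℓ : ℝ} (hh₁ : 0 ≤ h)
    (hlt : h₁ < h) (hle : h ≤ h')
    (hl : ∀ᶠ L : ℕ in atTop, ℓ * (((L + 1 : ℕ) : ℝ)) ^ 2 ≤ (dWaveSourceTorus (L + 1) U μ h₁).groundEnergy)
    (hu : ∀ᶠ L : ℕ in atTop, (dWaveSourceTorus (L + 1) U μ h).groundEnergy ≤ u * (((L + 1 : ℕ) : ℝ)) ^ 2) :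
    (ℓ - u) / (2 * (h - h₁)) ≤ liminf (fun L : ℕ => dWaveSourceDensity (L + 1) U μ h') atTop :=
  (le_liminf_dWaveSourceDensity_of_window U μ hlt hl hu).trans (liminf_dWaveSourceDensity_mono U μ hh₁ hle)

end OrderParameter

end Summit.Ventures.CertifiedManyBodySolver.Observables

end
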